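import Mathlib
import HarnessLib
import Summits.NavierStokesRegularity.NavierStokesRegularity.Theorems.LocalPressureProfileDoorPressureWindowToSlab
import Summits.NavierStokesRegularity.NavierStokesRegularity.Theorems.IsobarTomographyTubeAlternativeStubDefectAnalyticOfVelocity

/-!
# Route LocalLevelHeadDoor · crux `LevelHeadSpread` (stmt-NavierStokesRegularity-28096) · LINE g6-2 —
# STUB 1 `stub_levelWindowToEverywhere` (the LOAD-BEARING stub)

Seat ns-sz-p1 g5 (keyed by director-ns DIRECTOR-NS #237 (2)), `--supports stmt-NavierStokesRegularity-28096 --as helper`.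
Registered skeleton of record: planner ns-idea-6 g6, `LevelHeadSpread_birth.lean` (sha12 `e90d4cc6a43d`); this file proves
its stub `StubLevelWindowToEverywhere` VERBATIM (binders restated):

  for a door-class profile `v`, if for every `t < 0` the similarity head `y ↦ (−t)(Q[v(t)] + ½|v(t)|²)(√(−t)y)` takes
  equal values at any two points of a ball `B(c,r)`, then it takes equal values at ANY two points of `ℝ³`.

PROOF (all inputs are theorems of the tree).  Fix `t < 0` and write the similarity head as `H = P + V` with
`P(y) = (−t)Q[v(t)](√(−t)y)` — differentiable with real-analytic derivative
(`differentiable_and_analyticOnNhd_fderiv_profilePressure`) — and `V(y) = (−t)·½‖v(t)(√(−t)y)‖²`, real-analytic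
(slices of an Oseen-ancient field are analytic, `analyticOnNhd_slice`; inner products of analytic maps are analytic,
`analyticAt_inner_of_analyticAt`).  So `H` is differentiable with real-analytic derivative and constant on the open
ball, hence constant on `ℝ³` (`eq_of_isOpen_of_fderiv_analyticOnNhd`: identity theorem + mean value).

HONEST FRAMING: slice analyticity bookkeeping about HYPOTHETICAL Type-I profiles (stub of a DRAFT door route's crux);
nothing here bears on the door's Target, 0056 or Navier–Stokes regularity.
-/

noncomputable section

set_option linter.dupNamespace false

namespace Summit.NavierStokesRegularity.NavierStokesRegularity.Theorems.LevelHeadSpread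

open MeasureTheory Set Filter Topology Metric Function
open scoped RealInnerProductSpace
open Literature.Analysis Literature.Analysis.FluidPDE
open Summit.NavierStokesRegularity.NavierStokesRegularity.Theorems.LocalPressureProfileDoorPressureWindowToSlab
  (differentiable_and_analyticOnNhd_fderiv_profilePressure eq_of_isOpen_of_fderiv_analyticOnNhd)
open Summit.NavierStokesRegularity.NavierStokesRegularity.Theorems.LocalSineTubeDoorProfileAlignedWindowRigidityAncient
  (analyticOnNhd_slice bdd_of_hasTypeITimeDecay)
open Summit.NavierStokesRegularity.NavierStokesRegularity.Theorems.TubeAlternative.AnalyticPropagation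
  (analyticAt_inner_of_analyticAt)

/-- **The kinetic part of the similarity head is real-analytic**: `y ↦ (−t)·(‖v(t)(√(−t)y)‖²/2)` for `t < 0` and a
door-class profile `v`. [folklore] -/
theorem analyticOnNhd_kinetic {C : ℝ} {v : ℝ → EuclideanSpace ℝ (Fin 3) → EuclideanSpace ℝ (Fin 3)}
    (hrate : HasTypeITimeDecay C v) (hcont : ContinuousOn (uncurry v) (Iio (0 : ℝ) ×ˢ univ))
    (hmild : ∀ s t : ℝ, s < t → t < 0 → ∀ x,
      v t x = UnboundedOperators.heatExtension (v s) (t - s) x - oseenDuhamel 1 s v v t x)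
    {t : ℝ} (ht : t < 0) :
    AnalyticOnNhd ℝ (fun y : EuclideanSpace ℝ (Fin 3) => (-t) * (‖v t (Real.sqrt (-t) • y)‖ ^ 2 / 2)) univ := by
  intro y _
  have hsl : AnalyticOnNhd ℝ (v t) univ := analyticOnNhd_slice hcont (bdd_of_hasTypeITimeDecay hrate) hmild ht
  have hsm : AnalyticAt ℝ (fun w : EuclideanSpace ℝ (Fin 3) => Real.sqrt (-t) • w) y :=
    analyticAt_const.fun_smul analyticAt_id
  have hs : AnalyticAt ℝ (fun w : EuclideanSpace ℝ (Fin 3) => v t (Real.sqrt (-t) • w)) y :=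
    (hsl _ (mem_univ _)).comp hsm
  have hin : AnalyticAt ℝ (fun w : EuclideanSpace ℝ (Fin 3) =>
      ⟪v t (Real.sqrt (-t) • w), v t (Real.sqrt (-t) • w)⟫) y := analyticAt_inner_of_analyticAt hs hs
  have e : (fun w : EuclideanSpace ℝ (Fin 3) => (-t) * (‖v t (Real.sqrt (-t) • w)‖ ^ 2 / 2)) =
      fun w => (-t) * (⟪v t (Real.sqrt (-t) • w), v t (Real.sqrt (-t) • w)⟫ * (2 : ℝ)⁻¹) := by
    funext w; rw [real_inner_self_eq_norm_sq, div_eq_mul_inv]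
  rw [e]
  exact analyticAt_const.mul (hin.mul analyticAt_const)

/-- **Stub `stub_levelWindowToEverywhere` of the registered skeleton of crux `LevelHeadSpread`**
(stmt-NavierStokesRegularity-28096; LINE g6-2, planner ns-idea-6 g6, sha12 `e90d4cc6a43d`), signature VERBATIM
(`StubLevelWindowToEverywhere`): level on a ball of every slice ⇒ level at every pair of similarity positions. [folklore] -/
theorem levelWindowToEverywhere :
    ∀ (C D : ℝ) (v : ℝ → EuclideanSpace ℝ (Fin 3) → EuclideanSpace ℝ (Fin 3)), Literature.Analysis.FluidPDE.HasTypeITimeDecay C v → Literature.Analysis.FluidPDE.HasTypeIDecay D v → ContinuousOn (Function.uncurry v) (Set.Iio (0 : ℝ) ×ˢ Set.univ) → (∀ s t : ℝ, s < t → t < 0 → ∀ x, v t x = Literature.Analysis.UnboundedOperators.heatExtension (v s) (t - s) x - Literature.Analysis.FluidPDE.oseenDuhamel 1 s v v t x) → (∀ t < 0, Literature.Analysis.FluidPDE.VectorCalculus.IsDivFree (v t)) → ∀ (c : EuclideanSpace ℝ (Fin 3)) (r : ℝ), 0 < r → (∀ t < 0, ∀ y ∈ Metric.ball c r, ∀ y'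 ∈ Metric.ball c r, (-t) * (Literature.Analysis.FluidPDE.pressurePotential (v t) (Real.sqrt (-t) • y) + ‖v t (Real.sqrt (-t) • y)‖ ^ 2 / 2) = (-t) * (Literature.Analysis.FluidPDE.pressurePotential (v t) (Real.sqrt (-t) • y') + ‖v t (Real.sqrt (-t) • y')‖ ^ 2 / 2)) → ∀ t < 0, ∀ y y' : EuclideanSpace ℝ (Fin 3), (-t) * (Literature.Analysis.FluidPDE.pressurePotential (v t) (Real.sqrt (-t) • y) + ‖v t (Real.sqrt (-t) • y)‖ ^ 2 / 2) = (-t) * (Literature.Analysis.FluidPDE.pressurePotential (v t) (Real.sqrt (-t) • y') + ‖v t (Real.sqrt (-t) • y')‖ ^ 2 / 2) := by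
  intro C D v hrate hdec hcont hmild hdiv c r hr hlev t ht y y'
  -- the two parts of the similarity head
  set P : EuclideanSpace ℝ (Fin 3) → ℝ := fun w => (-t) * pressurePotential (v t) (Real.sqrt (-t) • w) with hP
  set V : EuclideanSpace ℝ (Fin 3) → ℝ := fun w => (-t) * (‖v t (Real.sqrt (-t) • w)‖ ^ 2 / 2) with hV
  set H : EuclideanSpace ℝ (Fin 3) → ℝ := fun w => P w + V w with hH
  have hHval : ∀ w, H w = (-t) * (pressurePotential (v t) (Real.sqrt (-t) • w) + ‖v t (Real.sqrt (-t) • w)‖ ^ 2 / 2) := by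
    intro w; simp only [hH, hP, hV]; ring
  obtain ⟨hPd, hPa⟩ := differentiable_and_analyticOnNhd_fderiv_profilePressure hdec hcont hmild hdiv ht
  have hVa : AnalyticOnNhd ℝ V univ := analyticOnNhd_kinetic hrate hcont hmild ht
  have hVd : Differentiable ℝ V := fun w => (hVa w (mem_univ w)).differentiableAt
  have hHd : Differentiable ℝ H := hPd.add hVd
  have hHD : AnalyticOnNhd ℝ (fderiv ℝ H) univ := by
    have e : fderiv ℝ H = fun w => fderiv ℝ P w + fderiv ℝ V w :=
      funext fun w => fderiv_add (hPd w) (hVd w)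
    rw [e]
    exact hPa.add hVa.fderiv
  -- constant on the ball, hence everywhere
  have hc : ∀ w ∈ ball c r, H w = H c := by
    intro w hw
    rw [hHval, hHval]
    exact hlev t ht w hw c (mem_ball_self hr)
  have hall := eq_of_isOpen_of_fderiv_analyticOnNhd hHd hHD isOpen_ball (mem_ball_self hr) hc
  rw [← hHval y, ← hHval y', hall y, hall y']

/-- Alias under the skeleton's stub name. [folklore] -/
theorem stub_levelWindowToEverywhere :
    ∀ (C D : ℝ) (v : ℝ → EuclideanSpace ℝ (Fin 3) → EuclideanSpace ℝ (Fin 3)), Literature.Analysis.FluidPDE.HasTypeITimeDecay C v → Literature.Analysis.FluidPDE.HasTypeIDecay D v → ContinuousOn (Function.uncurry v) (Set.Iio (0 : ℝ) ×ˢ Set.univ) → (∀ s t : ℝ, s < t → t < 0 → ∀ x, v t x = Literature.Analysis.UnboundedOperators.heatExtension (v s) (t - s) x - Literature.Analysis.FluidPDE.oseenDuhamel 1 s v v t x) → (∀ t < 0, Literature.Analysis.FluidPDE.VectorCalculus.IsDivFree (v t)) → ∀ (c : EuclideanSpace ℝ (Fin 3)) (r : ℝ), 0 < r → (∀ t < 0,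 ∀ y ∈ Metric.ball c r, ∀ y' ∈ Metric.ball c r, (-t) * (Literature.Analysis.FluidPDE.pressurePotential (v t) (Real.sqrt (-t) • y) + ‖v t (Real.sqrt (-t) • y)‖ ^ 2 / 2) = (-t) * (Literature.Analysis.FluidPDE.pressurePotential (v t) (Real.sqrt (-t) • y') + ‖v t (Real.sqrt (-t) • y')‖ ^ 2 / 2)) → ∀ t < 0, ∀ y y' : EuclideanSpace ℝ (Fin 3), (-t) * (Literature.Analysis.FluidPDE.pressurePotential (v t) (Real.sqrt (-t) • y) + ‖v t (Real.sqrt (-t) • y)‖ ^ 2 / 2) = (-t) * (Literature.Analysis.FluidPDE.pressurePotential (v t) (Real.sqrt (-t) • y') + ‖v t (Real.sqrt (-t) • y')‖ ^ 2 / 2) :=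
  levelWindowToEverywhere

end Summit.NavierStokesRegularity.NavierStokesRegularity.Theorems.LevelHeadSpread

end
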